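import Summits.Ventures.PercRepro.S1JointYSide3

/-!
# PercRepro — S1 THE `Y`-SIDE TERM `R₃` AT `7/5·D₄` (ref-2's R3 typed; p2, gen 15; SUBCLAIM-S1 §5 (Y3))

`S1YSide.ncard_rankLe3_ge_five_le` charges the rank-`≤ 3` sets with `≥ 5` points at `22·D₄`, `D₄ = s₃(n − 3) + s₄`
(its proof already gives `7·#planes` with `#planes ≤ D₄`). Every plane with `≥ 5` points contains `C(|P|, 4) ≥ 5`
four-subsets of rank `3`, and a rank-`3` four-set lies in exactly one plane (`closure_eq_of_four_subset`), so
`5·#planes ≤ D₄` and `5·#{A : r(A) ≤ 3, |A| ≥ 5} ≤ 35·#planes ≤ 7·D₄`. Since `7560 = 1512·5`: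

* **`five_mul_ncard_rankLe3_ge_five_le`** — `5·#{A ⊆ E : r(A) ≤ 3, |A| ≥ 5} ≤ 7·(s₃(n − 3) + s₄)`;
* **`midCount_ge_K7`** — `S1JointYSide3.midCount_ge_K` with `R₃ = 10584·(s₃(n − 3) + s₄)` in place of `7560·22·(…)`.
Axioms: standard.
-/

open scoped Matroid

namespace PercRepro

namespace S1

open Set

variable {α : Type}

/-- **(Y3) at `7/5`**: `5·#{A ⊆ E : r(A) ≤ 3, |A| ≥ 5} ≤ 7·(s₃·(n − 3) + s₄)`. -/
theorem five_mul_ncard_rankLe3_ge_five_le (M : Matroid α) [M.Finite]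
    (hcirc : ∀ C, M.IsCircuit C → 3 ≤ C.encard)
    (hline : ∀ L ⊆ M.E, M.eRk L ≤ 2 → L.ncard ≤ 3) (hplane : ∀ P ⊆ M.E, M.eRk P ≤ 3 → P.ncard ≤ 6) :
    5 * {A : Set α | A ⊆ M.E ∧ M.eRk A ≤ 3 ∧ 5 ≤ A.ncard}.ncard ≤
      7 * ({C : Set α | M.IsCircuit C ∧ C.ncard = 3}.ncard * (M.E.ncard - 3) +
        {C : Set α | M.IsCircuit C ∧ C.ncard = 4}.ncard) := by
  classical
  set T := {A : Set α | A ⊆ M.E ∧ M.eRk A ≤ 3 ∧ 5 ≤ A.ncard} with hT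
  have hTfin : T.Finite := M.ground_finite.finite_subsets.subset (fun A hA => hA.1)
  by_cases hrank : 2 ≤ M.eRank
  swap
  · have hempty : T = ∅ := by
      rw [Set.eq_empty_iff_forall_notMem]
      rintro A ⟨hAE, -, h5⟩
      have hle : M.eRk A ≤ 2 := (M.eRk_le_eRank A).trans (le_of_not_ge hrank)
      have := hline A hAE hle
      omega
    rw [hempty, ncard_empty]
    exact Nat.zero_le _
  have hs : ∀ e ∈ M.E, ∀ f ∈ M.E, e ≠ f → M.eRk {e, f} = 2 := fun e he f hf hef =>
    eRk_pair_eq_two_of_hcirc M hcirc he hf hef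
  have hD4 := CoreFour.ncard_four_sets_le (M := M) hs hrank
  set Tf := hTfin.toFinset with hTf
  have hmemT : ∀ A, A ∈ Tf ↔ A ⊆ M.E ∧ M.eRk A ≤ 3 ∧ 5 ≤ A.ncard := by
    intro A; rw [hTf, Set.Finite.mem_toFinset]; rfl
  set PL := Tf.image M.closure with hPL
  have hplaneP : ∀ P ∈ PL, P ⊆ M.E ∧ M.eRk P = 3 ∧ M.closure P = P ∧ 5 ≤ P.ncard ∧ P.ncard ≤ 6 := by
    intro P hP
    rw [hPL, Finset.mem_image] at hP
    obtain ⟨A, hA, rfl⟩ := hP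
    obtain ⟨hAE, hrA, h5⟩ := (hmemT A).1 hA
    have h3 : (3 : ℕ∞) ≤ M.eRk A := three_le_eRk_of_four_le_ncard M hline hAE (by omega)
    have hrA' : M.eRk A = 3 := le_antisymm hrA h3
    have hclE : M.closure A ⊆ M.E := M.closure_subset_ground A
    have hrcl : M.eRk (M.closure A) = 3 := by rw [M.eRk_closure_eq]; exact hrA'
    refine ⟨hclE, hrcl, M.closure_closure A, ?_, hplane _ hclE hrcl.le⟩
    exact h5.trans (Set.ncard_le_ncard (M.subset_closure A hAE) (M.ground_finite.subset hclE))
  -- per plane at most `7` members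
  have hfib : ∀ P ∈ PL, (Tf.filter (fun A => M.closure A = P)).card ≤ 7 := by
    intro P hP
    obtain ⟨hPE, -, -, -, h6⟩ := hplaneP P hP
    have hPfin : P.Finite := M.ground_finite.subset hPE
    rw [← Set.ncard_coe_finset]
    refine ((Set.ncard_le_ncard ?_ (hPfin.finite_subsets.subset (fun B hB => hB.1))).trans
      (ncard_subsets_Icc_le hPfin 6)).trans (beta_six_le _ h6)
    intro A hA
    rw [Finset.mem_coe, Finset.mem_filter, hmemT] at hA
    obtain ⟨⟨hAE, -, h5⟩, hclA⟩ := hA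
    have hAP : A ⊆ P := by rw [← hclA]; exact M.subset_closure A hAE
    exact ⟨hAP, h5, (Set.ncard_le_ncard hAP hPfin).trans h6⟩
  have hTcount : Tf.card ≤ 7 * PL.card := by
    rw [Finset.card_eq_sum_card_fiberwise (f := M.closure) (t := PL)
      (fun A hA => Finset.mem_image_of_mem _ hA)]
    calc ∑ P ∈ PL, (Tf.filter (fun A => M.closure A = P)).card ≤ ∑ _P ∈ PL, 7 := Finset.sum_le_sum hfib
      _ = 7 * PL.card := by rw [Finset.sum_const, smul_eq_mul, mul_comm]
  -- every plane carries `≥ 5` rank-`3` four-subsets, and a rank-`3` four-set lies in one plane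
  set g : Set α → Finset (Set α) := fun P =>
    ((M.ground_finite.subset (Set.inter_subset_left : M.E ∩ P ⊆ M.E)).toFinset.powersetCard 4).image
      (fun s : Finset α => (s : Set α)) with hg
  have hmemg : ∀ P ∈ PL, ∀ Q, Q ∈ g P ↔ Q ⊆ P ∧ Q.ncard = 4 := by
    intro P hP Q
    obtain ⟨hPE, -, -, -, -⟩ := hplaneP P hP
    have hEP : M.E ∩ P = P := Set.inter_eq_right.2 hPE
    rw [hg]
    simp only
    rw [mem_image_powersetCard_iff (M.ground_finite.subset (Set.inter_subset_left : M.E ∩ P ⊆ M.E)) 4 Q, hEP]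
  have hgcard : ∀ P ∈ PL, 5 ≤ (g P).card := by
    intro P hP
    obtain ⟨hPE, -, -, h5, -⟩ := hplaneP P hP
    have hEP : M.E ∩ P = P := Set.inter_eq_right.2 hPE
    rw [hg]
    simp only
    rw [card_image_powersetCard (M.ground_finite.subset (Set.inter_subset_left : M.E ∩ P ⊆ M.E)) 4, hEP]
    calc 5 = Nat.choose 5 4 := by decide
      _ ≤ P.ncard.choose 4 := Nat.choose_le_choose 4 h5
  have hgdisj : (PL : Set (Set α)).PairwiseDisjoint g := by
    intro P hP P' hP' hne
    rw [Function.onFun, Finset.disjoint_left]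
    intro Q hQ hQ'
    rw [Finset.mem_coe] at hP hP'
    rw [hmemg P hP] at hQ
    rw [hmemg P' hP'] at hQ'
    obtain ⟨hPE, hrP, hclP, -, -⟩ := hplaneP P hP
    obtain ⟨hP'E, hrP', hclP', -, -⟩ := hplaneP P' hP'
    have h1 := (closure_eq_of_four_subset M hline hPE hrP.le hQ.1 hQ.2).2
    have h2 := (closure_eq_of_four_subset M hline hP'E hrP'.le hQ'.1 hQ'.2).2
    exact hne (by rw [← hclP, ← h1, h2, hclP'])
  have hgsub : PL.biUnion g ⊆ (M.ground_finite.finite_subsets.subset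
      (fun X (hX : X ∈ {X : Set α | X ⊆ M.E ∧ X.ncard = 4 ∧ M.eRk X ≤ 3}) => hX.1)).toFinset := by
    intro Q hQ
    rw [Finset.mem_biUnion] at hQ
    obtain ⟨P, hP, hQP⟩ := hQ
    rw [hmemg P hP] at hQP
    obtain ⟨hPE, hrP, -, -, -⟩ := hplaneP P hP
    rw [Set.Finite.mem_toFinset]
    exact ⟨hQP.1.trans hPE, hQP.2, (M.eRk_mono hQP.1).trans hrP.le⟩
  have hPLcount : 5 * PL.card ≤ {X : Set α | X ⊆ M.E ∧ X.ncard = 4 ∧ M.eRk X ≤ 3}.ncard := by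
    calc 5 * PL.card = ∑ _P ∈ PL, 5 := by rw [Finset.sum_const, smul_eq_mul, mul_comm]
      _ ≤ ∑ P ∈ PL, (g P).card := Finset.sum_le_sum hgcard
      _ = (PL.biUnion g).card := (Finset.card_biUnion hgdisj).symm
      _ ≤ _ := by
          rw [Set.ncard_eq_toFinset_card _ (M.ground_finite.finite_subsets.subset
            (fun X (hX : X ∈ {X : Set α | X ⊆ M.E ∧ X.ncard = 4 ∧ M.eRk X ≤ 3}) => hX.1))]
          exact Finset.card_le_card hgsub
  have hD4' : {X : Set α | X ⊆ M.E ∧ X.ncard = 4 ∧ M.eRk X ≤ 3}.ncard ≤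
      {C : Set α | M.IsCircuit C ∧ C.ncard = 3}.ncard * (M.E.ncard - 3) +
        {C : Set α | M.IsCircuit C ∧ C.ncard = 4}.ncard := hD4
  have hTncard : T.ncard = Tf.card := Set.ncard_eq_toFinset_card _ hTfin
  rw [hTncard]
  omega

/-- **(Y1) THE `Y`-SIDE, WITH `R₃ = 10584·D₄`** (`10584 = 1512·7`, from `5·#T₃ ≤ 7·D₄`): `7560·Σ_{j=5}^{p−1} C(n, j) ≤ 7560·#Y(p, 4) + 10584·(s₃(n − 3) + s₄) +
RS 10·Π′_all + (RB 10 − RS 10)·Π′_{S₀}`. -/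
theorem midCount_ge_K7 (M : Matroid α) [M.Finite]
    (hcirc : ∀ C, M.IsCircuit C → 3 ≤ C.encard)
    (hline : ∀ L ⊆ M.E, M.eRk L ≤ 2 → L.ncard ≤ 3) (hplane : ∀ P ⊆ M.E, M.eRk P ≤ 3 → P.ncard ≤ 6)
    (hten : ∀ X ⊆ M.E, M.eRk X ≤ 4 → X.ncard ≤ 10) {d : ℕ} (hd : M.E.encard = M.eRank + d) (p : ℕ) :
    7560 * ∑ j ∈ Finset.Ico 5 p, M.E.ncard.choose j ≤
      7560 * Matroid.midCount M p 4 +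
      10584 * ({C : Set α | M.IsCircuit C ∧ C.ncard = 3}.ncard * (M.E.ncard - 3) +
        {C : Set α | M.IsCircuit C ∧ C.ncard = 4}.ncard) +
      (RSK 10 * ({C : Set α | M.IsCircuit C ∧ C.ncard = 3}.ncard * (M.E.ncard - 3).choose 2 +
        {C : Set α | M.IsCircuit C ∧ C.ncard = 4}.ncard * (M.E.ncard - 4) +
        {C : Set α | M.IsCircuit C ∧ C.ncard = 5}.ncard) +
      (RBK 10 - RSK 10) * ({C : Set α | M.IsCircuit C ∧ C.ncard = 3}.ncard * (min (5 * d) M.E.ncard - 3).choose 2 +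
        {C : Set α | M.IsCircuit C ∧ C.ncard = 4}.ncard * (min (5 * d) M.E.ncard - 4) +
        {C : Set α | M.IsCircuit C ∧ C.ncard = 5}.ncard)) := by
  classical
  have hY3 := five_mul_ncard_rankLe3_ge_five_le M hcirc hline hplane
  have hY2 := ncard_rankEq4_ge_five_le_K M hcirc hline hplane hten hd
  set Ef := M.ground_finite.toFinset with hEf
  have hEcard : Ef.card = M.E.ncard := (Set.ncard_eq_toFinset_card _ M.ground_finite).symm
  -- the sets with `5 ≤ |A| ≤ p − 1`: exactly `Σ_{j ∈ Ico 5 p} C(n, j)` of them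
  set 𝓑 : ℕ → Finset (Set α) := fun j => (Ef.powersetCard j).image (fun s : Finset α => (s : Set α)) with h𝓑
  have h𝓑card : ∀ j, (𝓑 j).card = M.E.ncard.choose j := fun j => by
    rw [h𝓑]; exact card_image_powersetCard M.ground_finite j
  have hmem𝓑 : ∀ j A, A ∈ 𝓑 j ↔ A ⊆ M.E ∧ A.ncard = j := fun j A =>
    mem_image_powersetCard_iff M.ground_finite j A
  have hdisj : ((Finset.Ico 5 p : Finset ℕ) : Set ℕ).PairwiseDisjoint 𝓑 := by
    intro i _ j _ hij
    rw [Function.onFun, Finset.disjoint_left]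
    intro A hA hA'
    rw [hmem𝓑] at hA hA'
    exact hij (hA.2.symm.trans hA'.2)
  set W := (Finset.Ico 5 p).biUnion 𝓑 with hW
  have hWcard : W.card = ∑ j ∈ Finset.Ico 5 p, M.E.ncard.choose j := by
    rw [hW, Finset.card_biUnion hdisj]
    exact Finset.sum_congr rfl (fun j _ => h𝓑card j)
  -- `W ⊆ Y ∪ T₃ ∪ T₄`
  set Y := {A : Set α | A ⊆ M.E ∧ (4 : ℕ∞) < M.eRk A ∧ M.eRk A < (p : ℕ∞)} with hY
  set T₃ := {A : Set α | A ⊆ M.E ∧ M.eRk A ≤ 3 ∧ 5 ≤ A.ncard} with hT₃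
  set T₄ := {A : Set α | A ⊆ M.E ∧ M.eRk A = 4 ∧ 5 ≤ A.ncard} with hT₄
  have hsub : (W : Set (Set α)) ⊆ Y ∪ T₃ ∪ T₄ := by
    intro A hA
    rw [Finset.mem_coe, hW, Finset.mem_biUnion] at hA
    obtain ⟨j, hj, hAj⟩ := hA
    rw [Finset.mem_Ico] at hj
    rw [hmem𝓑] at hAj
    obtain ⟨hAE, hAcard⟩ := hAj
    have hAfin : A.Finite := M.ground_finite.subset hAE
    have hlt : M.eRk A < (p : ℕ∞) := by
      calc M.eRk A ≤ A.encard := M.eRk_le_encard A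
        _ = (A.ncard : ℕ∞) := hAfin.cast_ncard_eq.symm
        _ < (p : ℕ∞) := by rw [hAcard]; exact_mod_cast hj.2
    by_cases h4 : (4 : ℕ∞) < M.eRk A
    · exact Or.inl (Or.inl ⟨hAE, h4, hlt⟩)
    · push Not at h4
      rcases h4.lt_or_eq with h | h
      · have h3 : M.eRk A ≤ 3 := by
          have : M.eRk A < (3 : ℕ∞) + 1 := by rw [show ((3 : ℕ∞) + 1) = 4 by norm_num]; exact h
          simpa using Order.le_of_lt_add_one this
        exact Or.inl (Or.inr ⟨hAE, h3, by omega⟩)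
      · exact Or.inr ⟨hAE, h, by omega⟩
  have hYfin : Y.Finite := M.ground_finite.finite_subsets.subset (fun A hA => hA.1)
  have hT₃fin : T₃.Finite := M.ground_finite.finite_subsets.subset (fun A hA => hA.1)
  have hT₄fin : T₄.Finite := M.ground_finite.finite_subsets.subset (fun A hA => hA.1)
  have hWle : W.card ≤ Y.ncard + T₃.ncard + T₄.ncard := by
    calc W.card = (W : Set (Set α)).ncard := (Set.ncard_coe_finset _).symm
      _ ≤ (Y ∪ T₃ ∪ T₄).ncard := Set.ncard_le_ncard hsub ((hYfin.union hT₃fin).union hT₄fin)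
      _ ≤ (Y ∪ T₃).ncard + T₄.ncard := Set.ncard_union_le _ _
      _ ≤ Y.ncard + T₃.ncard + T₄.ncard := by
          have := Set.ncard_union_le Y T₃
          omega
  have hmid : Matroid.midCount M p 4 = Y.ncard := rfl
  rw [← hWcard, hmid]
  have hY3' : 5 * T₃.ncard ≤ 7 * ({C : Set α | M.IsCircuit C ∧ C.ncard = 3}.ncard * (M.E.ncard - 3) +
      {C : Set α | M.IsCircuit C ∧ C.ncard = 4}.ncard) := hY3
  have hY2' : 7560 * T₄.ncard ≤ _ := hY2
  nlinarith [hWle, hY3', hY2']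

end S1

end PercRepro
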